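import Summits.CriticalPhenomena.CardyFormulaZ2.Theorems.CardyBoundaryCoulombGasBoundaryDefectGaussianRStubTransportPathsPart22
import Summits.CriticalPhenomena.CardyFormulaZ2.Theorems.CardyBoundaryCoulombGasBoundaryDefectGaussianRStubTransportPathsPart30
import Summits.CriticalPhenomena.CardyFormulaZ2.Theorems.CardyBoundaryCoulombGasBoundaryDefectGaussianRStubTransportPathsPart31

/-!
# Stub `stub_transportPaths` of line `rainbow-monomials-in-excursion-kernels` — Part 32:
# the transport path of one mover (either direction)
# (crux `CardyBoundaryCoulombGas.BoundaryDefectGaussianR`, stmt-CriticalPhenomena-14132)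

`tp_mover_paths`: for one mesh size, the transport path of the mover `m` from the parked
configuration before its move (slots for the already moved points, initial rail points for the
others) to the one after it, of length `≤ (M + 1) (W + 1)` with `≤ M` jumps, together with the
admissibility of the new configuration — counterclockwise movers (`mark m < α`, Parts 22, 29, 31)
and clockwise movers (`α < mark m`, Parts 22, 30, 31). [folklore]
-/

noncomputable section

open Set Filter Metric Topology Literature.Probability.RandomPlanarGeometry
open Literature.Probability.LatticeModels Literature.Probability.LatticeModels.CollarLegModel
open Summit.CriticalPhenomena.CardyFormulaZ2.Cruxes.RectilinearCardy.ExcursionKernelCovariance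

namespace Summit.CriticalPhenomena.CardyFormulaZ2.Cruxes.BoundaryDefectGaussianR.RainbowMonomialsInExcursionKernels

/-- Bounds of a mover's path: `(d + 1) (W + 1) ≤ (M + 1) (W + 1)` for `d ≤ M`. [folklore] -/
theorem tp_len_bound {d M W T : ℕ} (hd : d ≤ M) (hT : T ≤ (d + 1) * (W + 1)) :
    T ≤ (M + 1) * (W + 1) :=
  hT.trans (Nat.mul_le_mul_right _ (by omega))

/-- **Registered sub-goal `s7_lenBound` of stub `stub_transportPaths`** (bound of a mover's path
length, one-line form of `tp_len_bound`; `tp_mover_paths` exceeds the cap). [folklore] -/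
theorem s7_lenBound : ∀ (d M W T : ℕ), (d ≤ M) → (T ≤ (d + 1) * (W + 1)) → T ≤ (M + 1) * (W + 1) :=
  fun _ _ _ _ hd hT => tp_len_bound hd hT

set_option maxHeartbeats 4000000 in
/-- **The transport path of one mover.** See the module docstring. [folklore] -/
theorem tp_mover_paths {k : ℕ} (D : MarkedDomain k) {M : ℕ} {c : ℤ → ℝ} {a τ : ℤ → ℕ}
    (hcmono : StrictMono c) (hcper : ∀ z, c (z + M) = c z + 1)
    (ha4 : ∀ z, a z < 4) (hτ : ∀ z, τ z = 1 ∨ τ z = 3)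
    (hmodτ : ∀ z, (a z + τ z) % 4 = (a (z - 1) + 2) % 4)
    (hdir : ∀ z, ∀ t ∈ Icc (c z) (c (z + 1)), D.boundary t =
      D.boundary (c z) + ((‖D.boundary t - D.boundary (c z)‖ : ℝ) : ℂ) * Complex.I ^ (a z))
    (hmono : ∀ z, StrictMonoOn (fun t => ‖D.boundary t - D.boundary (c z)‖) (Icc (c z) (c (z + 1))))
    (hash : ∀ (z n : ℤ), a (z + n * M) = a z)
    {κ₀ : ℝ} (hκ₀ : ∀ z z' : ℤ, z + 2 ≤ z' → z' ≤ z + M - 2 →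
      ∀ t ∈ Icc (c z) (c (z + 1)), ∀ t' ∈ Icc (c z') (c (z' + 1)),
        κ₀ ≤ dist (D.boundary t) (D.boundary t'))
    {δ ρ r s₀ : ℝ} (hδ : 0 < δ) (hρδ : 64 * δ ≤ ρ) (hρr : ρ ≤ r) (hs₀ : 0 < s₀)
    {V : Finset (ℤ × ℤ)} (L : Fin k → ℕ) (j : Fin k) (G : ℕ)
    (hG : ∑ b ∈ Finset.univ.erase j, L b ≤ G) (hGr : 2 * (G : ℝ) ≤ r / δ)
    (K : ℤ → Fin 4) (hK : ∀ z, K z = Fin.ofNat 4 (a z)) (Y : ℤ → ℤ)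
    (hY : ∀ z, Y z = ⌈(D.boundary (c z) * (-Complex.I) ^ (a z)).im / δ⌉) (xon xoff : ℤ → ℤ)
    (Fl FlR : ℤ × ℤ → Prop) (Sep JumpOK : ℤ × ℤ → ℤ × ℤ → Prop)
    (hSep : ∀ u v, Sep u v ↔ (r / δ) ^ 2 ≤ ((((u.1 - v.1) ^ 2 + (u.2 - v.2) ^ 2 : ℤ)) : ℝ))
    (hJ : ∀ u v, JumpOK u v → JumpOK v u)
    (hA : ∀ (z x : ℤ), δ * ((⌈ρ / 4 / δ⌉₊ : ℕ) + 1) ≤ δ * x - (D.boundary (c z) * (-Complex.I) ^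
      (a z)).re → δ * x - (D.boundary (c z) * (-Complex.I) ^ (a z)).re ≤ ‖D.boundary (c (z + 1)) -
      D.boundary (c z)‖ - δ * ((⌈ρ / 4 / δ⌉₊ : ℕ) + 1) → Fl ((x) • dir (K (z)) + Y (z) • dir (K
      (z) + 1)) ∧ ((x) • dir (K (z)) + Y (z) • dir (K (z) + 1)) ∈ V ∧ ((x) • dir (K (z)) + Y (z) •
      dir (K (z) + 1)) + dir (K (z) + 3) ∉ V ∧ ((neighbours ((x) • dir (K (z)) + Y (z) • dir (K
      (z) + 1))).filter (fun w ↦ w ∉ V)).card = 1 ∧ outDart V ((x) • dir (K (z)) + Y (z) • dir (K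
      (z) + 1)) = some (((x) • dir (K (z)) + Y (z) • dir (K (z) + 1)), K (z) + 3))
    (hA' : ∀ (z x : ℤ), δ * ((⌈r / δ⌉₊ : ℕ) + 1) ≤ δ * x - (D.boundary (c z) * (-Complex.I) ^ (a
      z)).re → δ * x - (D.boundary (c z) * (-Complex.I) ^ (a z)).re ≤ ‖D.boundary (c (z + 1)) -
      D.boundary (c z)‖ - δ * ((⌈r / δ⌉₊ : ℕ) + 1) → FlR ((x) • dir (K (z)) + Y (z) • dir (K (z) +
      1)) ∧ Fl ((x) • dir (K (z)) + Y (z) • dir (K (z) + 1)) ∧ ((x) • dir (K (z)) + Y (z) • dir (K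
      (z) + 1)) ∈ V ∧ ((x) • dir (K (z)) + Y (z) • dir (K (z) + 1)) + dir (K (z) + 3) ∉ V ∧
      ((neighbours ((x) • dir (K (z)) + Y (z) • dir (K (z) + 1))).filter (fun w ↦ w ∉ V)).card = 1
      ∧ outDart V ((x) • dir (K (z)) + Y (z) • dir (K (z) + 1)) = some (((x) • dir (K (z)) + Y (z)
      • dir (K (z) + 1)), K (z) + 3))
    (hB : ∀ z : ℤ, JumpOK ((xoff z) • dir (K ((z - 1))) + Y ((z - 1)) • dir (K ((z - 1)) + 1))
      ((xon z) • dir (K (z)) + Y (z) • dir (K (z) + 1)) ∧ (∃ g : ℕ, (dsucc V)^[g] (((xoff z) • dir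
      (K ((z - 1))) + Y ((z - 1)) • dir (K ((z - 1)) + 1)), K (z - 1) + 3) = (((xon z) • dir (K
      (z)) + Y (z) • dir (K (z) + 1)), K z + 3)) ∧ (δ * ((((⌈ρ / 4 / δ⌉₊ + 3 : ℕ) : ℝ)) - 1) ≤ δ *
      (xon z : ℤ) - (D.boundary (c z) * (-Complex.I) ^ (a z)).re ∧ δ * (xon z : ℤ) - (D.boundary
      (c z) * (-Complex.I) ^ (a z)).re ≤ δ * ((((⌈ρ / 4 / δ⌉₊ + 3 : ℕ) : ℝ)) + 1)) ∧ (‖D.boundary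
      (c ((z - 1) + 1)) - D.boundary (c (z - 1))‖ - δ * ((((⌈ρ / 4 / δ⌉₊ + 3 : ℕ) : ℝ)) + 1) ≤ δ *
      (xoff z : ℤ) - (D.boundary (c (z - 1)) * (-Complex.I) ^ (a (z - 1))).re ∧ δ * (xoff z : ℤ) -
      (D.boundary (c (z - 1)) * (-Complex.I) ^ (a (z - 1))).re ≤ ‖D.boundary (c ((z - 1) + 1)) -
      D.boundary (c (z - 1))‖ - δ * ((((⌈ρ / 4 / δ⌉₊ + 3 : ℕ) : ℝ)) - 1)))
    (zm : Fin k → ℤ) (hzm : ∀ i, D.mark i ∈ Ioo (c (zm i)) (c (zm i + 1))) {α : ℝ} {zA : ℤ}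
    (hzA0 : a zA = 0) (hαA : α ∈ Ioo (c zA) (c (zA + 1))) (hα0 : 0 ≤ α) (hα1 : α < 1)
    {η₀ κ₁ dmm dA dmc dAc Λ ℓmin : ℝ} (hη₀ : 0 < η₀)
    (hκ₁ : ∀ s t : ℝ, (∀ n : ℤ, η₀ ≤ |s - t - n|) → κ₁ ≤ dist (D.boundary s) (D.boundary t))
    (hgap1 : ∀ i i', i ≠ i' → ∀ n : ℤ, 2 * η₀ ≤ |D.mark i - D.mark i' - n|)
    (hgap2 : ∀ i, ∀ n : ℤ, 2 * η₀ ≤ |α - D.mark i - n|)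
    (hdmm : ∀ i i', i ≠ i' → dmm ≤ dist (D.pt i) (D.pt i'))
    (hdA : ∀ i, dA ≤ dist (D.boundary α) (D.pt i))
    (hdmc : ∀ i, dmc ≤ ‖D.pt i - D.boundary (c (zm i))‖ ∧ dmc ≤ ‖D.boundary (c (zm i + 1)) - D.pt i‖)
    (hdAc : dAc ≤ ‖D.boundary α - D.boundary (c zA)‖ ∧ dAc ≤ ‖D.boundary (c (zA + 1)) - D.boundary α‖)
    (hΛ : ∀ z, ‖D.boundary (c (z + 1)) - D.boundary (c z)‖ ≤ Λ)
    (hℓmin : ∀ z, ℓmin ≤ ‖D.boundary (c (z + 1)) - D.boundary (c z)‖)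
    (hrκ₀ : 16 * r ≤ κ₀) (hrκ₁ : 16 * r ≤ κ₁) (hrdmm : 16 * r ≤ dmm) (hrdA : 16 * r ≤ dA)
    (hrdmc : 16 * r ≤ dmc) (hrdAc : 16 * r ≤ dAc) (hrℓ : 16 * r ≤ ℓmin) (hs₀A : 4 * s₀ ≤ dA)
    (hs₀Ac : 4 * s₀ ≤ dAc)
    (p : Fin k → ℤ × ℤ) (xi : Fin k → ℤ)
    (hp_eq : ∀ i, p i = (xi i) • dir (K (zm i)) + Y (zm i) • dir (K (zm i) + 1))
    (hp_coord : ∀ i, |δ * (xi i : ℤ) - ((D.boundary (c (zm i)) * (-Complex.I) ^ (a (zm i))).re +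
      ‖D.pt i - D.boundary (c (zm i))‖)| ≤ r / 4)
    (x : Fin k → ℤ) (hxmono : StrictMono x)
    (hxsep : ∀ i₁ i₂ : Fin k, i₁ ≠ i₂ → (r / δ) ^ 2 ≤ (((x i₁ - x i₂) ^ 2 : ℤ) : ℝ))
    (hxs₀ : ∀ i, |δ * (x i : ℤ)| ≤ s₀) (an1 : ℤ)
    (han1 : (D.boundary α).re - δ < δ * an1 ∧ δ * an1 ≤ (D.boundary α).re) :
    ∀ (m : Fin k) (Q : Fin k → ℤ × ℤ), Q m = p m → LegInsertionData.IsAdmissible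
      (⟨(Finset.univ.erase j).image (Q), fun v ↦ ∑ b ∈ (Finset.univ.erase j).filter (fun b ↦ (Q) b
      = v), L b, (Q) j⟩ : LegInsertionData) V → (D.mark m < α → (∀ i', i' ≠ m → Q i' = if m < i'
      then ((an1 + x i') • dir (K zA) + Y zA • dir (K zA + 1)) else p i') → ∃ T : ℕ, T ≤ (M + 1) *
      ((⌈Λ / δ⌉₊ + 2 : ℕ) + 1) ∧ (∃ (q : ℕ → Fin k → ℤ × ℤ) (σ' : ℕ → Bool), q 0 = Q ∧ q (T) =
      Function.update Q m ((an1 + x m) • dir (K zA) + Y zA • dir (K zA + 1)) ∧ ((Finset.range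
      (T)).filter (fun t => σ' t = false)).card ≤ M ∧ (∀ t, t ≤ T → (Function.Injective (q t) ∧
      LegInsertionData.IsAdmissible (⟨(Finset.univ.erase j).image (q t), fun v ↦ ∑ b ∈
      (Finset.univ.erase j).filter (fun b ↦ (q t) b = v), L b, (q t) j⟩ : LegInsertionData) V ∧ (∀
      i, Fl (q t i)) ∧ (∀ i₁ i₂ : Fin k, i₁ ≠ i₂ → Sep (q t i₁) (q t i₂)))) ∧ (∀ t, t < T → (σ' t
      = true → ∃ (i : Fin k) (τ : ℤ × ℤ), (τ = (1, 0) ∨ τ = (-1, 0) ∨ τ = (0, 1) ∨ τ = (0, -1)) ∧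
      q (t + 1) = Function.update (q t) i (q t i + τ)) ∧ (σ' t = false → ∃ (i : Fin k) (q' : ℤ ×
      ℤ), q (t + 1) = Function.update (q t) i q' ∧ (∀ i', i' ≠ i → FlR (q t i')) ∧ JumpOK (q t i)
      q'))) ∧ LegInsertionData.IsAdmissible (⟨(Finset.univ.erase j).image (Function.update Q m
      ((an1 + x m) • dir (K zA) + Y zA • dir (K zA + 1))), fun v ↦ ∑ b ∈ (Finset.univ.erase
      j).filter (fun b ↦ (Function.update Q m ((an1 + x m) • dir (K zA) + Y zA • dir (K zA + 1)))
      b = v), L b, (Function.update Q m ((an1 + x m) • dir (K zA) + Y zA • dir (K zA + 1))) j⟩ :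
      LegInsertionData) V) ∧ (α < D.mark m → (∀ i', i' ≠ m → (α < D.mark i' → i' < m → Q i' =
      ((an1 + x i') • dir (K zA) + Y zA • dir (K zA + 1))) ∧ (¬ (α < D.mark i' ∧ i' < m) → Q i' =
      p i')) → ∃ T : ℕ, T ≤ (M + 1) * ((⌈Λ / δ⌉₊ + 2 : ℕ) + 1) ∧ (∃ (q : ℕ → Fin k → ℤ × ℤ) (σ' :
      ℕ → Bool), q 0 = Q ∧ q (T) = Function.update Q m ((an1 + x m) • dir (K zA) + Y zA • dir (K
      zA + 1)) ∧ ((Finset.range (T)).filter (fun t => σ' t = false)).card ≤ M ∧ (∀ t, t ≤ T →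
      (Function.Injective (q t) ∧ LegInsertionData.IsAdmissible (⟨(Finset.univ.erase j).image (q
      t), fun v ↦ ∑ b ∈ (Finset.univ.erase j).filter (fun b ↦ (q t) b = v), L b, (q t) j⟩ :
      LegInsertionData) V ∧ (∀ i, Fl (q t i)) ∧ (∀ i₁ i₂ : Fin k, i₁ ≠ i₂ → Sep (q t i₁) (q t
      i₂)))) ∧ (∀ t, t < T → (σ' t = true → ∃ (i : Fin k) (τ : ℤ × ℤ), (τ = (1, 0) ∨ τ = (-1, 0) ∨
      τ = (0, 1) ∨ τ = (0, -1)) ∧ q (t + 1) = Function.update (q t) i (q t i + τ)) ∧ (σ' t = false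
      → ∃ (i : Fin k) (q' : ℤ × ℤ), q (t + 1) = Function.update (q t) i q' ∧ (∀ i', i' ≠ i → FlR
      (q t i')) ∧ JumpOK (q t i) q'))) ∧ LegInsertionData.IsAdmissible (⟨(Finset.univ.erase
      j).image (Function.update Q m ((an1 + x m) • dir (K zA) + Y zA • dir (K zA + 1))), fun v ↦ ∑
      b ∈ (Finset.univ.erase j).filter (fun b ↦ (Function.update Q m ((an1 + x m) • dir (K zA) + Y
      zA • dir (K zA + 1))) b = v), L b, (Function.update Q m ((an1 + x m) • dir (K zA) + Y zA •
      dir (K zA + 1))) j⟩ : LegInsertionData) V) := by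
  classical
  intro m Q hQm hadm
  have hr : 0 < r := by linarith
  have hδr : 64 * δ ≤ r := hρδ.trans hρr
  set Good : (Fin k → ℤ × ℤ) → Prop := fun Q => Function.Injective Q ∧
    LegInsertionData.IsAdmissible
      (⟨(Finset.univ.erase j).image Q, fun v ↦ ∑ b ∈ (Finset.univ.erase j).filter
        (fun b ↦ Q b = v), L b, Q j⟩ : LegInsertionData) V ∧
    (∀ i, Fl (Q i)) ∧ (∀ i₁ i₂ : Fin k, i₁ ≠ i₂ → Sep (Q i₁) (Q i₂)) with hGood
  set Step : (Fin k → ℤ × ℤ) → (Fin k → ℤ × ℤ) → Bool → Prop := fun Q Q' b =>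
    (b = true → ∃ (i : Fin k) (τ : ℤ × ℤ), (τ = (1, 0) ∨ τ = (-1, 0) ∨ τ = (0, 1) ∨
      τ = (0, -1)) ∧ Q' = Function.update Q i (Q i + τ)) ∧
    (b = false → ∃ (i : Fin k) (q' : ℤ × ℤ), Q' = Function.update Q i q' ∧
      (∀ i', i' ≠ i → FlR (Q i')) ∧ JumpOK (Q i) q') with hStep
  have hSepG : ∀ u v, Sep u v → (G : ℤ) ≤ max |u.1 - v.1| |u.2 - v.2| :=
    fun u v h => tp_sepG hGr u v ((hSep u v).1 h)
  have hSepne : ∀ u v, Sep u v → u ≠ v :=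
    fun u v h => tp_sep_ne (by positivity) u v ((hSep u v).1 h)
  obtain ⟨hFp, hFs, hSpp, hSss, hSps⟩ := tp_parked_facts D hcmono ha4 hdir hmono hδ hδr K hK Y hY Fl
    FlR Sep hSep hA' zm hzm hzA0 hαA hdmm hdA hdmc hdAc hrdmm hrdA hrdmc hrdAc hs₀A hs₀Ac p xi hp_eq
    hp_coord x hxsep hxs₀ an1 han1
  constructor
  · ------------------------------------------------------------------ counterclockwise
    intro hm hQP
    set P : Fin k → ℤ × ℤ := fun i' => if m < i' then (an1 + x i') • dir (K zA) + Y zA • dir (K zA + 1)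
      else p i' with hPdef
    have hP : ∀ i', i' ≠ m → P i' = if m < i' then (an1 + x i') • dir (K zA) + Y zA • dir (K zA + 1)
        else p i' := fun _ _ => rfl
    obtain ⟨hrail, hjump, hord⟩ := tp_ccw_facts D hcmono hcper ha4 hτ hmodτ hdir hmono hash hκ₀ hδ hρδ
      hρr hs₀ K hK Y hY xon xoff Fl Sep JumpOK hSep hA hB zm hzm hzA0 hαA hα1 hη₀ hκ₁ hgap1 hgap2 hdmm
      hdA hdmc hdAc hΛ hℓmin hrκ₀ hrκ₁ hrdmm hrdA hrdmc hrdAc hrℓ hs₀A hs₀Ac p xi hp_eq hp_coord x hxmono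
      hxsep hxs₀ an1 han1 m hm P hP
    have hFlP : ∀ i', i' ≠ m → Fl (P i') := by
      intro i' hi'; rw [hP i' hi']; split_ifs; exacts [(hFs i').1, (hFp i').1]
    have hFlRP : ∀ i', i' ≠ m → FlR (P i') := by
      intro i' hi'; rw [hP i' hi']; split_ifs; exacts [(hFs i').2, (hFp i').2]
    have hSepP : ∀ i₁ i₂, i₁ ≠ m → i₂ ≠ m → i₁ ≠ i₂ → Sep (P i₁) (P i₂) := by
      intro i₁ i₂ h₁ h₂ h12
      rw [hP i₁ h₁, hP i₂ h₂]
      split_ifs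
      · exact hSss i₁ i₂ h12
      · exact (hSps i₂ i₁).2
      · exact (hSps i₁ i₂).1
      · exact hSpp i₁ i₂ h12
    have hzsA : zm m ≤ zA := by
      by_contra h
      have := hcmono.monotone (show zA + 1 ≤ zm m by omega); linarith [hαA.2, (hzm m).1, hm]
    have hzAs : zA ≤ zm m + M := by
      by_contra h
      have h1 := hcmono.monotone (show zm m + 1 + M ≤ zA by omega)
      have h2 := hcper (zm m + 1); linarith [hαA.1, (hzm m).2, (D.mark_mem m).1, hα1]
    set d := (zA - zm m).toNat with hd
    have hdz : zm m + d = zA := by rw [hd, Int.toNat_of_nonneg (by omega)]; ring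
    have hdM : d ≤ M := by
      have : (d : ℤ) ≤ M := by rw [hd, Int.toNat_of_nonneg (by omega)]; omega
      exact_mod_cast this
    obtain ⟨T, hT, hpath, hadm'⟩ := tp_mover_fwd k L j V G Fl FlR Sep JumpOK hG hSepG hSepne K Y xon
      xoff m zA (an1 + x m) (⌈Λ / δ⌉₊ + 2) P hFlP hFlRP hSepP d (zm m) (xi m) hdz hrail hjump hord Q
      (fun i' hi' => by rw [hQP i' hi', hP i' hi']) (by rw [hQm, hp_eq m]) hadm
    exact ⟨T, tp_len_bound hdM hT, tp_path_mono Good Step hdM hpath, hadm'⟩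
  · ------------------------------------------------------------------ clockwise
    intro hm hQP
    set P : Fin k → ℤ × ℤ := fun i' => if α < D.mark i' ∧ i' < m then
      (an1 + x i') • dir (K zA) + Y zA • dir (K zA + 1) else p i' with hPdef
    have hP : ∀ i', i' ≠ m → (α < D.mark i' → i' < m → P i' = (an1 + x i') • dir (K zA) +
        Y zA • dir (K zA + 1)) ∧ (¬ (α < D.mark i' ∧ i' < m) → P i' = p i') :=
      fun i' _ => ⟨fun h1 h2 => if_pos ⟨h1, h2⟩, fun h => if_neg h⟩
    have hJ' : ∀ u v, JumpOK u v → JumpOK v u := hJ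
    obtain ⟨hrail, hjump, hord⟩ := tp_cw_facts D hcmono hcper ha4 hτ hmodτ hdir hmono hash hκ₀ hδ hρδ
      hρr hs₀ K hK Y hY xon xoff Fl Sep JumpOK hSep hJ' hA hB zm hzm hzA0 hαA hα0 hη₀ hκ₁ hgap1 hgap2
      hdmm hdA hdmc hdAc hΛ hℓmin hrκ₀ hrκ₁ hrdmm hrdA hrdmc hrdAc hrℓ hs₀A hs₀Ac p xi hp_eq hp_coord x
      hxmono hxsep hxs₀ an1 han1 m hm P hP
    have hFlP : ∀ i', i' ≠ m → Fl (P i') := by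
      intro i' hi'; simp only [hPdef]; split_ifs; exacts [(hFs i').1, (hFp i').1]
    have hFlRP : ∀ i', i' ≠ m → FlR (P i') := by
      intro i' hi'; simp only [hPdef]; split_ifs; exacts [(hFs i').2, (hFp i').2]
    have hSepP : ∀ i₁ i₂, i₁ ≠ m → i₂ ≠ m → i₁ ≠ i₂ → Sep (P i₁) (P i₂) := by
      intro i₁ i₂ h₁ h₂ h12
      simp only [hPdef]
      split_ifs
      · exact hSss i₁ i₂ h12
      · exact (hSps i₂ i₁).2
      · exact (hSps i₁ i₂).1
      · exact hSpp i₁ i₂ h12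
    have hzAs : zA ≤ zm m := by
      by_contra h
      have := hcmono.monotone (show zm m + 1 ≤ zA by omega); linarith [hαA.1, (hzm m).2, hm]
    have hzsA : zm m ≤ zA + M := by
      by_contra h
      have h1 := hcmono.monotone (show zA + 1 + M ≤ zm m by omega)
      have h2 := hcper (zA + 1); linarith [hαA.2, (hzm m).1, (D.mark_mem m).2, hα0]
    set d := (zm m - zA).toNat with hd
    have hdz : zA + d = zm m := by rw [hd, Int.toNat_of_nonneg (by omega)]; ring
    have hdM : d ≤ M := by
      have : (d : ℤ) ≤ M := by rw [hd, Int.toNat_of_nonneg (by omega)]; omega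
      exact_mod_cast this
    have hQP' : ∀ i', i' ≠ m → Q i' = P i' := by
      intro i' hi'
      by_cases h : α < D.mark i' ∧ i' < m
      · rw [(hP i' hi').1 h.1 h.2]; exact (hQP i' hi').1 h.1 h.2
      · rw [(hP i' hi').2 h]; exact (hQP i' hi').2 h
    obtain ⟨T, hT, hpath, hadm'⟩ := tp_mover_bwd k L j V G Fl FlR Sep JumpOK hG hSepG hSepne K Y xon
      xoff m zA (an1 + x m) (⌈Λ / δ⌉₊ + 2) P hFlP hFlRP hSepP d (zm m) (xi m) hdz hrail hjump hord Q
      hQP' (by rw [hQm, hp_eq m]) hadm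
    exact ⟨T, tp_len_bound hdM hT, tp_path_mono Good Step hdM hpath, hadm'⟩

end Summit.CriticalPhenomena.CardyFormulaZ2.Cruxes.BoundaryDefectGaussianR.RainbowMonomialsInExcursionKernels

end
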